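import Mathlib
import Summits.NavierStokesRegularity.NavierStokesRegularity.Theorems.EulerZoomLiouvillePowerGaugeEulerLiouvilleSelfSimilarPastProfileGradient
import HarnessLib

/-!
# PAST-EXACT self-similar members of crux E: the `D`-gauge (pressure) in profile variables at LARGE SCALES
# (crux `EulerZoomLiouville.PowerGaugeEulerLiouville` = stmt-NavierStokesRegularity-19832, line `birth`, rung C1 — transport brick 3)

Route `EulerZoomLiouville` (NavierStokesRegularity); width seat ns-ezl-w1 under the interim LEAD ns-typeII-p2 g9 (assignment
of 2026-08-28T03:17:55Z; brick 3 of the transport of the profile dictionary to members that are exactly self-similar about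
`(T, x₀)` on a past sub-slab `τ < T₁` only, `T₁ ≤ 0`, `T₁ ≤ T`).  Companion of `…SelfSimilarPastProfileGradient` (brick 1, the
gradient) and `…SelfSimilarPastProfileDissipation` (brick 2, the `E`-gauge); the `A`-gauge twin is the tree's
`Shifted.profile_energy_growth_of_gaugeA_past`.  Here the power gauge `a^{2ρ} D(a; 0; p) ≤ c` (all `a > 0`; `D = cknD`, the
scaled `L^{3/2}` pressure quantity on `Q_a(0,0) = (−a², 0) × B_a`) of a member with
`p(τ, x) = (T − τ)^{2(γ−1)} P((T − τ)^{−γ}(x − x₀))` for `τ < T₁` is read in profile variables AT LARGE SCALES — the twin of the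
ball form `∫_{B_L}|P|^{3/2} ≤ ((2−2ρ)/(2+ρ)) c L^{2−2ρ}` of the lineage's dictionary (`profile_pressure_weight_of_gaugeD` +
`EnergySaturation.lintegral_ball_pressure_le_of_weight`), same exponent `2 − 2ρ`:

* `Past.lintegral_ball_enorm_rpow_shiftedPressure_ge` — per slice: for `s > 0` and `s^{γ} L + ‖x₀‖ ≤ a`,
  `s^{6γ−3} ∫_{B_L} |P|^{3/2} ≤ ∫_{B_a} |s^{2(γ−1)} P(s^{−γ}(· − x₀))|^{3/2}` (affine change of variables `x = x₀ + s^{γ} y`);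
* `Past.profile_pressure_growth_of_gaugeD_past` — THE BRICK: `a^{2ρ} D(a; 0; p) ≤ c` (all `a > 0`), `p` past-exactly
  self-similar about `(T, x₀)` with profile `P` for `τ < T₁`, `γ = 1/(2+ρ)`, `0 < ρ < 1` ⇒ for some `C < ∞`:
  `∫_{B_L} |P|^{3/2} ≤ C L^{2−2ρ}` for every `L ≥ 2 − T₁` (window `τ ∈ (T₁ − 2, T₁ − 1)` of `Q_a(0,0)`,
  `a = (T − T₁ + 2)^{γ} L + ‖x₀‖`, Tonelli, the slice lemma, time weight `(T − τ)^{6γ−3} ≥ (T − T₁ + 2)^{6γ−3}`).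

WHAT THIS IS NOT: not NS, not E, not a stub of the skeleton — a transport lemma `--supports` stmt-19832 (only the
large-scale ball form transports; the weighted form `∫|P|^{3/2}|y|^{2ρ−2} < ∞` over all of `ℝ³` does not follow for past-exact
members). [folklore]
-/

noncomputable section

-- flat `Theorems/<Route><Decl>…` files of one crux share the namespace of the crux (tree convention: `Summit.<S>.<S>.…`)
set_option linter.dupNamespace false

open MeasureTheory Set Filter Topology Metric Function TopologicalSpace
open scoped ENNReal NNReal

namespace Summit.NavierStokesRegularity.NavierStokesRegularity.Theorems.PowerGaugeEulerLiouville

open Literature.Analysis Literature.Analysis.FunctionSpaces Literature.Analysis.FluidPDE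

namespace Past

/-! ### Per slice: the shifted pressure ansatz on a large ball dominates the profile pressure on `B_L` -/

/-- **Ball integrals of `|p|^{3/2}` for a shifted pressure ansatz — the large-scale lower bound.**  For `s > 0`, a pressure
profile `P`, and radii with `s^{γ} L + ‖x₀‖ ≤ a`:
`s^{6γ−3} ∫_{B_L(0)} |P|^{3/2} ≤ ∫_{B_a(0)} |s^{2(γ−1)} P(s^{−γ}(x − x₀))|^{3/2} dx`
(`|s^{2(γ−1)}|^{3/2} = s^{3γ−3}`, the affine change of variables `x = x₀ + s^{γ} y` with Jacobian `s^{3γ}`, whose image of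
`B_L(0)` lies in `B_a(0)`).  The tree's `lintegral_ball_enorm_rpow_selfSimilarCollapsePressure` is the exact identity at
`x₀ = 0`. [folklore] -/
theorem lintegral_ball_enorm_rpow_shiftedPressure_ge (γ : ℝ) {s : ℝ} (hs : 0 < s)
    (x₀ : EuclideanSpace ℝ (Fin 3)) (P : EuclideanSpace ℝ (Fin 3) → ℝ)
    {a L : ℝ} (hLa : s ^ γ * L + ‖x₀‖ ≤ a) :
    ENNReal.ofReal (s ^ (6 * γ - 3)) *
        ∫⁻ y in ball (0 : EuclideanSpace ℝ (Fin 3)) L, ‖P y‖ₑ ^ (3 / 2 : ℝ) ≤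
      ∫⁻ x in ball (0 : EuclideanSpace ℝ (Fin 3)) a,
        ‖s ^ (2 * (γ - 1)) * P (s ^ (-γ) • (x - x₀))‖ₑ ^ (3 / 2 : ℝ) := by
  set σ : ℝ := s ^ γ with hσ
  have hσ0 : 0 < σ := Real.rpow_pos_of_pos hs _
  set F : EuclideanSpace ℝ (Fin 3) → ℝ≥0∞ := fun x => ‖P (s ^ (-γ) • (x - x₀))‖ₑ ^ (3 / 2 : ℝ) with hF
  -- pointwise scaling of the integrand
  have h1 : ∀ x, ‖s ^ (2 * (γ - 1)) * P (s ^ (-γ) • (x - x₀))‖ₑ ^ (3 / 2 : ℝ) =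
      ENNReal.ofReal (s ^ (3 * (γ - 1))) * F x := by
    intro x
    simp only [hF]
    rw [enorm_mul, ENNReal.mul_rpow_of_nonneg _ _ (by norm_num),
      Real.enorm_eq_ofReal (Real.rpow_nonneg hs.le _), ENNReal.ofReal_rpow_of_nonneg (Real.rpow_nonneg hs.le _)
        (by norm_num), ← Real.rpow_mul hs.le]
    congr 3
    ring
  -- the affine change of variables `x = x₀ + σ y`
  have hval : ∀ y, F (x₀ + σ • y) = ‖P y‖ₑ ^ (3 / 2 : ℝ) := by
    intro y
    simp only [hF, add_sub_cancel_left, smul_smul]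
    rw [hσ, ← Real.rpow_add hs, show -γ + γ = 0 by ring, Real.rpow_zero, one_smul]
  have hpre : ball (0 : EuclideanSpace ℝ (Fin 3)) L ⊆
      (fun y : EuclideanSpace ℝ (Fin 3) => x₀ + σ • y) ⁻¹' ball (0 : EuclideanSpace ℝ (Fin 3)) a := by
    intro y hy
    rw [mem_ball_zero_iff] at hy
    rw [mem_preimage, mem_ball_zero_iff]
    calc ‖x₀ + σ • y‖ ≤ ‖x₀‖ + ‖σ • y‖ := norm_add_le _ _
      _ = ‖x₀‖ + σ * ‖y‖ := by rw [norm_smul, Real.norm_of_nonneg hσ0.le]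
      _ < ‖x₀‖ + σ * L := by gcongr
      _ ≤ a := by rw [hσ]; linarith
  have hcov := setLIntegral_preimage_comp_space_affine hσ0 x₀ F (ball (0 : EuclideanSpace ℝ (Fin 3)) a)
  rw [finrank_euclideanSpace_fin] at hcov
  have hmain : ∫⁻ y in ball (0 : EuclideanSpace ℝ (Fin 3)) L, ‖P y‖ₑ ^ (3 / 2 : ℝ) ≤
      ENNReal.ofReal (σ ^ 3)⁻¹ * ∫⁻ x in ball (0 : EuclideanSpace ℝ (Fin 3)) a, F x := by
    rw [← hcov]
    calc ∫⁻ y in ball (0 : EuclideanSpace ℝ (Fin 3)) L, ‖P y‖ₑ ^ (3 / 2 : ℝ)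
        = ∫⁻ y in ball (0 : EuclideanSpace ℝ (Fin 3)) L, F (x₀ + σ • y) :=
          lintegral_congr fun y => (hval y).symm
      _ ≤ ∫⁻ y in (fun y : EuclideanSpace ℝ (Fin 3) => x₀ + σ • y) ⁻¹' ball (0 : EuclideanSpace ℝ (Fin 3)) a,
            F (x₀ + σ • y) := lintegral_mono_set hpre
  -- the constants: `s^{6γ−3} σ^{−3} = s^{3(γ−1)}`
  have hσ3 : σ ^ 3 = s ^ (3 * γ) := by
    rw [hσ, ← Real.rpow_natCast, ← Real.rpow_mul hs.le]
    congr 1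
    push_cast
    ring
  have hcoef : ENNReal.ofReal (s ^ (6 * γ - 3)) * ENNReal.ofReal (σ ^ 3)⁻¹ =
      ENNReal.ofReal (s ^ (3 * (γ - 1))) := by
    rw [← ENNReal.ofReal_mul (Real.rpow_nonneg hs.le _), hσ3, ← Real.rpow_neg hs.le, ← Real.rpow_add hs,
      show 6 * γ - 3 + -(3 * γ) = 3 * (γ - 1) by ring]
  calc ENNReal.ofReal (s ^ (6 * γ - 3)) *
        ∫⁻ y in ball (0 : EuclideanSpace ℝ (Fin 3)) L, ‖P y‖ₑ ^ (3 / 2 : ℝ)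
      ≤ ENNReal.ofReal (s ^ (6 * γ - 3)) *
          (ENNReal.ofReal (σ ^ 3)⁻¹ * ∫⁻ x in ball (0 : EuclideanSpace ℝ (Fin 3)) a, F x) :=
        mul_le_mul' le_rfl hmain
    _ = ENNReal.ofReal (s ^ (3 * (γ - 1))) * ∫⁻ x in ball (0 : EuclideanSpace ℝ (Fin 3)) a, F x := by
        rw [← mul_assoc, hcoef]
    _ = ∫⁻ x in ball (0 : EuclideanSpace ℝ (Fin 3)) a,
          ‖s ^ (2 * (γ - 1)) * P (s ^ (-γ) • (x - x₀))‖ₑ ^ (3 / 2 : ℝ) := by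
        rw [← lintegral_const_mul' _ _ ENNReal.ofReal_ne_top]
        exact lintegral_congr fun x => (h1 x).symm

/-! ### The brick: the `D`-gauge of a past-exact member in profile variables, large scales -/

/-- **THE `D`-GAUGE OF A PAST-EXACT MEMBER IN PROFILE VARIABLES (large scales).**  Let `p` be a.e.-strongly measurable on the
slab `(−∞,0) × ℝ³` with `p(τ, x) = (T − τ)^{2(γ−1)} P((T − τ)^{−γ}(x − x₀))` for `τ < T₁` (`T₁ ≤ 0`, `T₁ ≤ T`, `γ = 1/(2+ρ)`,
`0 < ρ < 1`), and suppose the power gauge `a^{2ρ} D(a; 0; p) ≤ c` for all `a > 0`.  Then for some `C < ∞`: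
`∫_{B_L} |P|^{3/2} ≤ C L^{2−2ρ}` for every `L ≥ 2 − T₁`.  Proof: for such `L` put `S = T − T₁ + 2`, `a = S^{γ} L + ‖x₀‖` (so
`a² ≥ 2 − T₁`); the window `(T₁ − 2, T₁ − 1) × B_a` lies in `Q_a(0,0)`, so by Tonelli and the slice lemma
`∫_{T₁−2}^{T₁−1} (T−τ)^{6γ−3} dτ · ∫_{B_L}|P|^{3/2} ≤ ∫∫_{Q_a}|p|^{3/2} ≤ a^{2−2ρ} c`, and `(T − τ)^{6γ−3} ≥ S^{6γ−3}` on the window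
(`6γ − 3 ≤ 0`); `C = S^{3−6γ} (S^{γ} + ‖x₀‖)^{2−2ρ} c`.  `profile_pressure_weight_of_gaugeD` (ball form) is the case
`T = T₁ = 0`, `x₀ = 0`. [folklore] -/
theorem profile_pressure_growth_of_gaugeD_past {ρ : ℝ} (hρ : 0 < ρ) (hρ1 : ρ < 1)
    {T T₁ : ℝ} (hT₁ : T₁ ≤ 0) (hTT₁ : T₁ ≤ T) (x₀ : EuclideanSpace ℝ (Fin 3))
    {p : ℝ → EuclideanSpace ℝ (Fin 3) → ℝ} {P : EuclideanSpace ℝ (Fin 3) → ℝ} {c : ℝ≥0}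
    (hpm : AEStronglyMeasurable (uncurry p)
      (volume.restrict (Iio (0 : ℝ) ×ˢ (univ : Set (EuclideanSpace ℝ (Fin 3))))))
    (hp : ∀ τ : ℝ, τ < T₁ → p τ = fun x => selfSimilarCollapsePressure (1 / (2 + ρ)) T P τ (x - x₀))
    (hD : ∀ a : ℝ, 0 < a →
      ENNReal.ofReal (a ^ (2 * ρ)) * cknD a (0 : ℝ × EuclideanSpace ℝ (Fin 3)) p ≤ (c : ℝ≥0∞)) :
    ∃ C : ℝ≥0∞, C ≠ ⊤ ∧ ∀ L : ℝ, 2 - T₁ ≤ L →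
      ∫⁻ y in ball (0 : EuclideanSpace ℝ (Fin 3)) L, ‖P y‖ₑ ^ (3 / 2 : ℝ) ≤
        C * ENNReal.ofReal (L ^ (2 - 2 * ρ)) := by
  set γ : ℝ := 1 / (2 + ρ) with hγ
  have h2ρ : 0 < 2 + ρ := by linarith
  have hγ0 : 0 < γ := by rw [hγ]; positivity
  have hγ63 : 6 * γ - 3 ≤ 0 := by
    have : γ ≤ 1 / 2 := by
      rw [hγ, div_le_div_iff₀ h2ρ two_pos]; linarith
    linarith
  have h2ρ' : 0 ≤ 2 - 2 * ρ := by linarith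
  -- the time scale `S = T − T₁ + 2` of the window `(T₁ − 2, T₁ − 1)` and the constant
  set S : ℝ := T - T₁ + 2 with hS
  have hS2 : 2 ≤ S := by rw [hS]; linarith
  have hS0 : 0 < S := by linarith
  set σ : ℝ := S ^ γ with hσ
  have hσ0 : 0 < σ := Real.rpow_pos_of_pos hS0 _
  have hσ1 : 1 ≤ σ := Real.one_le_rpow (by linarith) hγ0.le
  set k : ℝ := S ^ (3 - 6 * γ) * (σ + ‖x₀‖) ^ (2 - 2 * ρ) with hk
  refine ⟨ENNReal.ofReal k * (c : ℝ≥0∞), ENNReal.mul_ne_top ENNReal.ofReal_ne_top ENNReal.coe_ne_top,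
    fun L hL => ?_⟩
  have hL2 : 2 ≤ L := by linarith
  have hL0 : 0 < L := by linarith
  -- ### the radius `a = σ L + ‖x₀‖`
  set a : ℝ := σ * L + ‖x₀‖ with ha
  have haL : L ≤ a := by
    have : 1 * L ≤ σ * L := mul_le_mul_of_nonneg_right hσ1 hL0.le
    have := norm_nonneg x₀
    rw [ha]; linarith
  have ha0 : 0 < a := by linarith
  have ha2 : 2 - T₁ ≤ a ^ 2 := by nlinarith
  -- ### (1) the gauge: `X = ∫∫_{Q_a} |p|^{3/2} ≤ a^{2−2ρ} c`
  set X : ℝ≥0∞ := ∫⁻ q in parabolicCylinder a (0 : ℝ × EuclideanSpace ℝ (Fin 3)),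
    ‖p q.1 q.2‖ₑ ^ (3 / 2 : ℝ) with hX
  have hXle : X ≤ ENNReal.ofReal (a ^ (2 - 2 * ρ)) * (c : ℝ≥0∞) := by
    have h1 := hD a ha0
    unfold cknD at h1
    have hA0 : ENNReal.ofReal a ^ 2 ≠ 0 := pow_ne_zero _ (by rw [ENNReal.ofReal_ne_zero_iff]; exact ha0)
    have hAtop : ENNReal.ofReal a ^ 2 ≠ ⊤ := ENNReal.pow_ne_top ENNReal.ofReal_ne_top
    have hB0 : ENNReal.ofReal (a ^ (2 * ρ)) ≠ 0 := by
      rw [ENNReal.ofReal_ne_zero_iff]; exact Real.rpow_pos_of_pos ha0 _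
    have key : X = ENNReal.ofReal a ^ 2 * (ENNReal.ofReal (a ^ (2 * ρ)))⁻¹ *
        (ENNReal.ofReal (a ^ (2 * ρ)) * ((ENNReal.ofReal a ^ 2)⁻¹ * X)) := by
      rw [← mul_assoc, mul_assoc (ENNReal.ofReal a ^ 2), ENNReal.inv_mul_cancel hB0 ENNReal.ofReal_ne_top,
        mul_one, ← mul_assoc, ENNReal.mul_inv_cancel hA0 hAtop, one_mul]
    calc X = _ := key
      _ ≤ ENNReal.ofReal a ^ 2 * (ENNReal.ofReal (a ^ (2 * ρ)))⁻¹ * (c : ℝ≥0∞) := by gcongr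
      _ = ENNReal.ofReal (a ^ (2 - 2 * ρ)) * (c : ℝ≥0∞) := by
          rw [← ENNReal.ofReal_inv_of_pos (Real.rpow_pos_of_pos ha0 _), ← ENNReal.ofReal_pow ha0.le,
            ← ENNReal.ofReal_mul (by positivity)]
          congr 2
          rw [Real.rpow_sub ha0, Real.rpow_two, div_eq_mul_inv]
  -- ### (2) the window `(T₁ − 2, T₁ − 1) × B_a` inside `Q_a(0,0)`
  have hWsub : Ioo (T₁ - 2) (T₁ - 1) ×ˢ ball (0 : EuclideanSpace ℝ (Fin 3)) a ⊆
      parabolicCylinder a (0 : ℝ × EuclideanSpace ℝ (Fin 3)) := by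
    intro q hq
    rw [mem_prod, mem_Ioo, mem_ball] at hq
    rw [mem_parabolicCylinder, Prod.fst_zero, Prod.snd_zero, zero_sub]
    exact ⟨⟨by linarith [hq.1.1], by linarith [hq.1.2]⟩, hq.2⟩
  have hY : ∫⁻ q in Ioo (T₁ - 2) (T₁ - 1) ×ˢ ball (0 : EuclideanSpace ℝ (Fin 3)) a,
      ‖p q.1 q.2‖ₑ ^ (3 / 2 : ℝ) ≤ X :=
    lintegral_mono_set hWsub
  -- ### (3) Tonelli on the window
  have hpmW : AEMeasurable (fun q : ℝ × EuclideanSpace ℝ (Fin 3) => ‖p q.1 q.2‖ₑ ^ (3 / 2 : ℝ))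
      (((volume : Measure ℝ).restrict (Ioo (T₁ - 2) (T₁ - 1))).prod
        ((volume : Measure (EuclideanSpace ℝ (Fin 3))).restrict (ball 0 a))) := by
    have hsub : Ioo (T₁ - 2) (T₁ - 1) ×ˢ ball (0 : EuclideanSpace ℝ (Fin 3)) a ⊆
        Iio (0 : ℝ) ×ˢ (univ : Set (EuclideanSpace ℝ (Fin 3))) :=
      prod_mono (fun t ht => by have := ht.2; rw [mem_Iio]; linarith) (subset_univ _)
    have := (hpm.mono_measure (Measure.restrict_mono hsub le_rfl)).enorm.pow_const (3 / 2 : ℝ)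
    rwa [Measure.volume_eq_prod, ← Measure.prod_restrict] at this
  have hYeq : ∫⁻ q in Ioo (T₁ - 2) (T₁ - 1) ×ˢ ball (0 : EuclideanSpace ℝ (Fin 3)) a,
        ‖p q.1 q.2‖ₑ ^ (3 / 2 : ℝ) =
      ∫⁻ τ in Ioo (T₁ - 2) (T₁ - 1), ∫⁻ x in ball (0 : EuclideanSpace ℝ (Fin 3)) a,
        ‖p τ x‖ₑ ^ (3 / 2 : ℝ) := by
    rw [Measure.volume_eq_prod, ← Measure.prod_restrict, lintegral_prod _ hpmW]
  -- ### (4) the lower bound on the slices of the window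
  set J : ℝ≥0∞ := ∫⁻ y in ball (0 : EuclideanSpace ℝ (Fin 3)) L, ‖P y‖ₑ ^ (3 / 2 : ℝ) with hJ
  have hlow : ∀ᵐ τ ∂((volume : Measure ℝ).restrict (Ioo (T₁ - 2) (T₁ - 1))),
      ENNReal.ofReal (S ^ (6 * γ - 3)) * J ≤
        ∫⁻ x in ball (0 : EuclideanSpace ℝ (Fin 3)) a, ‖p τ x‖ₑ ^ (3 / 2 : ℝ) := by
    filter_upwards [ae_restrict_mem measurableSet_Ioo] with τ hτW
    have hτ : τ < T₁ := by have := hτW.2; linarith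
    have hs : 0 < T - τ := by linarith
    have hsS : T - τ ≤ S := by have := hτW.1; rw [hS]; linarith
    have hpτ : (fun x => ‖p τ x‖ₑ ^ (3 / 2 : ℝ)) = fun x =>
        ‖(T - τ) ^ (2 * (γ - 1)) * P ((T - τ) ^ (-γ) • (x - x₀))‖ₑ ^ (3 / 2 : ℝ) := by
      funext x
      rw [hp τ hτ]
      simp only [selfSimilarCollapsePressure_apply]
    rw [hpτ]
    have hLa : (T - τ) ^ γ * L + ‖x₀‖ ≤ a := by
      have : (T - τ) ^ γ ≤ σ := Real.rpow_le_rpow hs.le hsS hγ0.le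
      rw [ha]; nlinarith
    calc ENNReal.ofReal (S ^ (6 * γ - 3)) * J ≤ ENNReal.ofReal ((T - τ) ^ (6 * γ - 3)) * J :=
          mul_le_mul' (ENNReal.ofReal_le_ofReal (Real.rpow_le_rpow_of_nonpos hs hsS hγ63)) le_rfl
      _ ≤ _ := lintegral_ball_enorm_rpow_shiftedPressure_ge γ hs x₀ P hLa
  -- ### (5) integrate the lower bound over the window (length `1`)
  have hvolW : volume (Ioo (T₁ - 2) (T₁ - 1)) = 1 := by
    rw [Real.volume_Ioo, show T₁ - 1 - (T₁ - 2) = (1 : ℝ) by ring, ENNReal.ofReal_one]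
  have hJle : ENNReal.ofReal (S ^ (6 * γ - 3)) * J ≤ X :=
    calc ENNReal.ofReal (S ^ (6 * γ - 3)) * J
        = ∫⁻ _ in Ioo (T₁ - 2) (T₁ - 1), ENNReal.ofReal (S ^ (6 * γ - 3)) * J := by
          rw [setLIntegral_const, hvolW, mul_one]
      _ ≤ ∫⁻ τ in Ioo (T₁ - 2) (T₁ - 1), ∫⁻ x in ball (0 : EuclideanSpace ℝ (Fin 3)) a,
            ‖p τ x‖ₑ ^ (3 / 2 : ℝ) := lintegral_mono_ae hlow
      _ = _ := hYeq.symm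
      _ ≤ X := hY
  -- ### (6) assemble
  have haL' : a ^ (2 - 2 * ρ) ≤ (σ + ‖x₀‖) ^ (2 - 2 * ρ) * L ^ (2 - 2 * ρ) := by
    rw [← Real.mul_rpow (by positivity) hL0.le]
    refine Real.rpow_le_rpow ha0.le ?_ h2ρ'
    have : ‖x₀‖ ≤ ‖x₀‖ * L := le_mul_of_one_le_right (norm_nonneg _) (by linarith)
    rw [ha]; nlinarith
  have hunit : ENNReal.ofReal (S ^ (3 - 6 * γ)) * ENNReal.ofReal (S ^ (6 * γ - 3)) = 1 := by
    rw [← ENNReal.ofReal_mul (Real.rpow_nonneg hS0.le _), ← Real.rpow_add hS0,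
      show (3 - 6 * γ) + (6 * γ - 3) = 0 by ring, Real.rpow_zero, ENNReal.ofReal_one]
  calc J = ENNReal.ofReal (S ^ (3 - 6 * γ)) * (ENNReal.ofReal (S ^ (6 * γ - 3)) * J) := by
        rw [← mul_assoc, hunit, one_mul]
    _ ≤ ENNReal.ofReal (S ^ (3 - 6 * γ)) * X := by gcongr
    _ ≤ ENNReal.ofReal (S ^ (3 - 6 * γ)) * (ENNReal.ofReal (a ^ (2 - 2 * ρ)) * (c : ℝ≥0∞)) := by gcongr
    _ ≤ ENNReal.ofReal (S ^ (3 - 6 * γ)) *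
          (ENNReal.ofReal ((σ + ‖x₀‖) ^ (2 - 2 * ρ) * L ^ (2 - 2 * ρ)) * (c : ℝ≥0∞)) := by gcongr
    _ = ENNReal.ofReal k * (c : ℝ≥0∞) * ENNReal.ofReal (L ^ (2 - 2 * ρ)) := by
        rw [hk, ENNReal.ofReal_mul (by positivity), ENNReal.ofReal_mul (by positivity)]
        ring

end Past

end Summit.NavierStokesRegularity.NavierStokesRegularity.Theorems.PowerGaugeEulerLiouville
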